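import Summits.ResolutionOfSingularities.ResolutionOfSingularities.Theorems.WeightedInvariantWeightedConstructionLexmaxHullDefs

/-!
# Fat points: no admissible chart profile at the origin of `𝔸ⁿ` for `𝔪₀²` exceeds `(2,…,2,⊤,…)`

[OURS · L1 W4.3 · chain w43, stub worker 4] Algebraic core of the chart facts for the hull-escape
family (`Theorems/WeightedInvariantWeightedConstructionHullEscape.lean`), line `pointwise-lexmax-hull`
of crux `WeightedConstruction` (stmt-ResolutionOfSingularities-0571). NOT a statement of any manuscript.

Write `𝟚ₙ := chartProfile (m := n) 2 (fun _ => 1) = (2,…,2,⊤,…)` (`n` twos): the profile of the chart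
`(x₁,…,xₙ; 1,…,1; d = 2)` of the fat point `(𝔸ⁿ, 𝔪₀²)`.

* `twoProfile_succ_lt`, `twoProfile_lt_of_lt`: `𝟚ₙ₊₁ < 𝟚ₙ` — the fat-point values STRICTLY DESCEND in
  the `⊤`-padded lexicographic order of `Profile` (a truncated profile is larger).
* `exists_index_of_twoProfile_lt`: `𝟚ₙ < chartProfile d w` (antitone positive weights) forces, for
  some `i < n`, `i ≤ m`: `d = 2wⱼ` for `j < i` and `2wⱼ < d` for `i ≤ j`.
* `three_le_weightedDegree`: then every exponent `α` of the weighted piece (`d ≤ Σ wⱼαⱼ`) has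
  `3 ≤ Σⱼ eⱼ αⱼ`, `eⱼ = 2` for `j < i`, `eⱼ = 1` otherwise.
* MAIN `chartProfile_le_twoProfile_of_sq_le`: in ANY localisation `L` of `k[x₁,…,xₙ]` at the origin,
  if `v₁,…,vₘ ∈ 𝔪_L`, `w` antitone positive, `d > 0` and `(𝔪₀L)² ≤ (v^α : Σ wⱼαⱼ ≥ d)` then
  `chartProfile d w ≤ 𝟚ₙ`. Proof: restrict to a line `t ↦ t·c` (`xₗ ↦ cₗ t`, a `k`-algebra map
  `φ : k[x] → k[t]`) with `c` in the common kernel of the linear parts of the numerators of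
  `v₀,…,v_{i−1}` and `c_l ≠ 0` for some `l` (possible as `i < n`, `LinearMap.ker_ne_bot_of_finrank_lt`):
  every generator restricts into `(t³)`, while a cleared-denominator multiple `T·x_l²` (`T(0) ≠ 0`)
  restricts to a polynomial with `t²`-coefficient `T(0)c_l² ≠ 0`.
No linear independence of the chart is needed for this upper bound.
-/

noncomputable section

open Literature.AlgebraicGeometry.Resolution
open scoped Polynomial

set_option linter.dupNamespace false -- mandated namespace of this single-conjunct summit

namespace Summit.ResolutionOfSingularities.ResolutionOfSingularities.Theorems.PointwiseLexmaxHull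

/-! ## The profiles `(2,…,2,⊤,…)` -/

/-- Entries of a chart profile below the length. [OURS · folklore] -/
theorem ofLex_chartProfile_of_lt {m : ℕ} (d : ℕ) (w : Fin m → ℕ) {j : ℕ} (hj : j < m) :
    ofLex (chartProfile d w) j = (((d : ℚ) / (w ⟨j, hj⟩ : ℚ) : ℚ) : WithTop ℚ) := by
  change (if h : j < m then (((d : ℚ) / (w ⟨j, h⟩ : ℚ) : ℚ) : WithTop ℚ) else ⊤) = _
  rw [dif_pos hj]

/-- Entries of a chart profile beyond the length are `⊤`. [OURS · folklore] -/
theorem ofLex_chartProfile_of_le {m : ℕ} (d : ℕ) (w : Fin m → ℕ) {j : ℕ} (hj : m ≤ j) :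
    ofLex (chartProfile d w) j = ⊤ := by
  change (if h : j < m then (((d : ℚ) / (w ⟨j, h⟩ : ℚ) : ℚ) : WithTop ℚ) else ⊤) = _
  rw [dif_neg (not_lt.mpr hj)]

/-- Entries of `(2,…,2,⊤,…)` below `n` are `2`. [OURS · folklore] -/
theorem ofLex_twoProfile_of_lt {n j : ℕ} (hj : j < n) :
    ofLex (chartProfile (m := n) 2 (fun _ => 1)) j = ((2 : ℚ) : WithTop ℚ) := by
  rw [ofLex_chartProfile_of_lt 2 _ hj]
  norm_num

/-- Entries of `(2,…,2,⊤,…)` beyond `n` are `⊤`. [OURS · folklore] -/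
theorem ofLex_twoProfile_of_le {n j : ℕ} (hj : n ≤ j) :
    ofLex (chartProfile (m := n) 2 (fun _ => 1)) j = ⊤ := by
  rw [ofLex_chartProfile_of_le 2 _ hj]

/-- Unfolding the lexicographic `<` on profiles. [OURS · folklore] -/
theorem Profile.lt_iff {π π' : Profile} :
    π < π' ↔ ∃ i : ℕ, (∀ j : ℕ, j < i → ofLex π j = ofLex π' j) ∧ ofLex π i < ofLex π' i :=
  Iff.rfl

/-- **The fat-point values strictly descend**: `(2,…,2,2,⊤,…) < (2,…,2,⊤,…)` — a truncated profile is
LARGER in the `⊤`-padded lexicographic order. [OURS · folklore] -/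
theorem twoProfile_succ_lt (n : ℕ) :
    chartProfile (m := n + 1) 2 (fun _ => 1) < chartProfile (m := n) 2 (fun _ => 1) := by
  rw [Profile.lt_iff]
  refine ⟨n, fun j hj => ?_, ?_⟩
  · rw [ofLex_twoProfile_of_lt hj, ofLex_twoProfile_of_lt (Nat.lt_succ_of_lt hj)]
  · rw [ofLex_twoProfile_of_lt (Nat.lt_succ_self n), ofLex_twoProfile_of_le le_rfl]
    exact WithTop.coe_lt_top _

/-- `(2,…,2,⊤,…)` with `n'` twos is below the one with `n < n'` twos. [OURS · folklore] -/
theorem twoProfile_lt_of_lt {n n' : ℕ} (h : n < n') :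
    chartProfile (m := n') 2 (fun _ => 1) < chartProfile (m := n) 2 (fun _ => 1) := by
  induction h with
  | refl => exact twoProfile_succ_lt n
  | step _ ih => exact (twoProfile_succ_lt _).trans ih

/-! ## Shape of a chart profile exceeding `(2,…,2,⊤,…)` -/

/-- **Index lemma.** If `(2,…,2,⊤,…) < chartProfile d w` (`n` twos; positive antitone weights), then
for some `i < n` with `i ≤ m`: `d = 2wⱼ` for `j < i` and `2wⱼ < d` for `i ≤ j`. [OURS · folklore] -/
theorem exists_index_of_twoProfile_lt {n m d : ℕ} {w : Fin m → ℕ} (hw : ∀ j, 0 < w j)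
    (hanti : Antitone w) (h : chartProfile (m := n) 2 (fun _ => 1) < chartProfile d w) :
    ∃ i : ℕ, i < n ∧ i ≤ m ∧ (∀ j : Fin m, (j : ℕ) < i → d = 2 * w j) ∧
      (∀ j : Fin m, i ≤ (j : ℕ) → 2 * w j < d) := by
  rw [Profile.lt_iff] at h
  obtain ⟨i, heq, hlt⟩ := h
  -- `i < n`: nothing lies above `⊤`
  have hin : i < n := by
    by_contra hin
    rw [ofLex_twoProfile_of_le (not_lt.mp hin)] at hlt
    exact not_top_lt hlt
  -- `i ≤ m`: otherwise position `m` differs (`2 ≠ ⊤`)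
  have him : i ≤ m := by
    by_contra him
    have hm := heq m (not_le.mp him)
    rw [ofLex_twoProfile_of_lt (lt_trans (not_le.mp him) hin), ofLex_chartProfile_of_le d w le_rfl]
      at hm
    exact WithTop.coe_ne_top hm
  refine ⟨i, hin, him, fun j hj => ?_, ?_⟩
  · -- positions before `i` agree: `2 = d / wⱼ`
    have hj' := heq j hj
    rw [ofLex_twoProfile_of_lt (lt_trans hj hin), ofLex_chartProfile_of_lt d w j.2,
      WithTop.coe_eq_coe] at hj'
    have hwj : (0 : ℚ) < w j := by exact_mod_cast hw j
    have hd : (d : ℚ) = 2 * (w j : ℚ) := by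
      have := hj'.symm
      rw [div_eq_iff hwj.ne'] at this
      simpa using this
    exact_mod_cast hd
  · -- at position `i` (if `i < m`) the entry exceeds `2`; antitone weights propagate
    intro j hij
    rcases Nat.lt_or_ge i m with him' | him'
    · rw [ofLex_twoProfile_of_lt hin, ofLex_chartProfile_of_lt d w him', WithTop.coe_lt_coe] at hlt
      have hwi : (0 : ℚ) < w ⟨i, him'⟩ := by exact_mod_cast hw _
      have h2 : (2 : ℚ) * w ⟨i, him'⟩ < d := by rwa [lt_div_iff₀ hwi] at hlt
      have h2' : 2 * w ⟨i, him'⟩ < d := by exact_mod_cast h2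
      have hmono : w j ≤ w ⟨i, him'⟩ := hanti (show (⟨i, him'⟩ : Fin m) ≤ j from hij)
      lia
    · exact absurd (lt_of_lt_of_le j.2 him') (not_lt.mpr hij)

/-- **Weighted degree lemma.** With `d > 0`, `d = 2wⱼ` for `j < i` and `2wⱼ < d` for `i ≤ j`, every
exponent `α` of the weighted piece (`d ≤ Σ wⱼ αⱼ`) satisfies `3 ≤ Σⱼ eⱼ αⱼ` where `eⱼ = 2` for
`j < i` and `eⱼ = 1` otherwise (termwise `2wⱼαⱼ ≤ d eⱼ αⱼ`, strictly at a nonzero `αⱼ`).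
[OURS · folklore] -/
theorem three_le_weightedDegree {m d i : ℕ} {w : Fin m → ℕ} (hw : ∀ j, 0 < w j) (hd : 0 < d)
    (h2 : ∀ j : Fin m, (j : ℕ) < i → d = 2 * w j) (h3 : ∀ j : Fin m, i ≤ (j : ℕ) → 2 * w j < d)
    (α : Fin m → ℕ) (hα : d ≤ ∑ j, w j * α j) :
    3 ≤ ∑ j : Fin m, (if (j : ℕ) < i then 2 else 1) * α j := by
  have hterm : ∀ j : Fin m, 2 * (w j * α j) ≤ d * ((if (j : ℕ) < i then 2 else 1) * α j) := by
    intro j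
    split_ifs with hj
    · rw [h2 j hj]; lia
    · have := h3 j (not_lt.mp hj); nlinarith
  obtain ⟨j₀, hj₀⟩ : ∃ j, 0 < α j := by
    by_contra hnone
    push Not at hnone
    have : ∑ j, w j * α j = 0 := Finset.sum_eq_zero fun j _ => by simp [Nat.le_zero.mp (hnone j)]
    lia
  have hstrict : 2 * (w j₀ * α j₀) < d * ((if (j₀ : ℕ) < i then 2 else 1) * α j₀) := by
    split_ifs with hj
    · rw [h2 j₀ hj]; nlinarith [hw j₀]
    · have := h3 j₀ (not_lt.mp hj); nlinarith
  have hsum : ∑ j : Fin m, 2 * (w j * α j) <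
      ∑ j : Fin m, d * ((if (j : ℕ) < i then 2 else 1) * α j) :=
    Finset.sum_lt_sum (fun j _ => hterm j) ⟨j₀, Finset.mem_univ _, hstrict⟩
  rw [← Finset.mul_sum, ← Finset.mul_sum] at hsum
  have h6 : d * 2 < d * ∑ j : Fin m, (if (j : ℕ) < i then 2 else 1) * α j := by lia
  have := Nat.lt_of_mul_lt_mul_left h6
  lia

/-! ## Restriction of `k[x₁,…,xₙ]` to a line through the origin -/

section Line

variable {n : ℕ} {k : Type} [Field k] (c : Fin n → k)
  (φ : MvPolynomial (Fin n) k →ₐ[k] k[X])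
  (hφ : ∀ l, φ (MvPolynomial.X l) = Polynomial.C (c l) * Polynomial.X)
include hφ

/-- Along the line `xₗ ↦ cₗ t`, the constant term is the constant term. [OURS · folklore] -/
theorem coeff_zero_lineMap (p : MvPolynomial (Fin n) k) :
    (φ p).coeff 0 = MvPolynomial.constantCoeff p := by
  rw [Polynomial.coeff_zero_eq_eval_zero]
  have h : (Polynomial.evalRingHom 0).comp φ.toRingHom = MvPolynomial.eval (0 : Fin n → k) := by
    apply MvPolynomial.ringHom_ext
    · intro a
      simp
    · intro l
      simp [hφ]
  simpa [MvPolynomial.eval_zero] using RingHom.congr_fun h p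

/-- Along the line `xₗ ↦ cₗ t`, the linear term is `Σₗ (∂p/∂xₗ)(0) · cₗ`. [OURS · folklore] -/
theorem coeff_one_lineMap (p : MvPolynomial (Fin n) k) :
    (φ p).coeff 1 = ∑ l, MvPolynomial.coeff (Finsupp.single l 1) p * c l := by
  classical
  induction p using MvPolynomial.induction_on with
  | C a =>
    have h0 : ∀ x : Fin n, (0 : Fin n →₀ ℕ) ≠ Finsupp.single x 1 :=
      fun x => (Finsupp.single_ne_zero.mpr one_ne_zero).symm
    have hC : φ (MvPolynomial.C a) = Polynomial.C a := by
      rw [← MvPolynomial.algebraMap_eq, AlgHom.commutes, Polynomial.algebraMap_eq]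
    rw [hC, Polynomial.coeff_C]
    simp [MvPolynomial.coeff_C, h0]
  | add p q hp hq =>
    simp only [map_add, Polynomial.coeff_add, MvPolynomial.coeff_add, add_mul,
      Finset.sum_add_distrib, hp, hq]
  | mul_X p l hp =>
    rw [map_mul, hφ, ← mul_assoc, Polynomial.coeff_mul_X, Polynomial.coeff_mul_C,
      coeff_zero_lineMap c φ hφ, show MvPolynomial.constantCoeff p = MvPolynomial.coeff 0 p from rfl]
    simp_rw [MvPolynomial.coeff_mul_X', Finsupp.mem_support_iff, Finsupp.single_apply]
    rw [Finset.sum_eq_single l]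
    · simp
    · intro l' _ hl'
      simp [hl']
    · intro h; exact absurd (Finset.mem_univ l) h

/-- A polynomial vanishing at the origin restricts into `(t)`. [OURS · folklore] -/
theorem X_dvd_lineMap {p : MvPolynomial (Fin n) k} (hp : MvPolynomial.constantCoeff p = 0) :
    Polynomial.X ∣ φ p := by
  rw [Polynomial.X_dvd_iff, coeff_zero_lineMap c φ hφ]
  exact hp

/-- A polynomial vanishing at the origin whose linear part vanishes along `c` restricts into `(t²)`.
[OURS · folklore] -/
theorem X_sq_dvd_lineMap {p : MvPolynomial (Fin n) k} (hp : MvPolynomial.constantCoeff p = 0)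
    (hc : ∑ l, MvPolynomial.coeff (Finsupp.single l 1) p * c l = 0) :
    Polynomial.X ^ 2 ∣ φ p := by
  rw [Polynomial.X_pow_dvd_iff]
  intro e he
  interval_cases e
  · rw [coeff_zero_lineMap c φ hφ]; exact hp
  · rw [coeff_one_lineMap c φ hφ]; exact hc

/-- Restrictions of weighted monomials in polynomials vanishing at the origin, the first `i` of whose
linear parts vanish along `c`, lie in `(t³)` once `3 ≤ Σ eⱼ αⱼ`. [OURS · folklore] -/
theorem X_pow_three_dvd_lineMap_prod {m i : ℕ} (q : Fin m → MvPolynomial (Fin n) k)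
    (hq : ∀ j, MvPolynomial.constantCoeff (q j) = 0)
    (hc : ∀ j : Fin m, (j : ℕ) < i → ∑ l, MvPolynomial.coeff (Finsupp.single l 1) (q j) * c l = 0)
    (α : Fin m → ℕ) (hα : 3 ≤ ∑ j : Fin m, (if (j : ℕ) < i then 2 else 1) * α j) :
    Polynomial.X ^ 3 ∣ φ (∏ j, q j ^ α j) := by
  have hfac : ∀ j : Fin m, Polynomial.X ^ (if (j : ℕ) < i then 2 else 1) ∣ φ (q j) := by
    intro j
    split_ifs with hj
    · exact X_sq_dvd_lineMap c φ hφ (hq j) (hc j hj)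
    · rw [pow_one]; exact X_dvd_lineMap c φ hφ (hq j)
  have hprod : Polynomial.X ^ (∑ j : Fin m, (if (j : ℕ) < i then 2 else 1) * α j) ∣
      φ (∏ j, q j ^ α j) := by
    rw [map_prod, ← Finset.prod_pow_eq_pow_sum]
    apply Finset.prod_dvd_prod_of_dvd
    intro j _
    rw [map_pow, pow_mul]
    exact pow_dvd_pow_of_dvd (hfac j) (α j)
  exact (pow_dvd_pow Polynomial.X hα).trans hprod

omit hφ in
/-- **Choosing the line.** For fewer than `n` polynomials there is a direction `c` along which all
their linear parts vanish and some coordinate `c_l ≠ 0`. [OURS · folklore] -/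
theorem exists_line {i : ℕ} (hin : i < n) (q : Fin i → MvPolynomial (Fin n) k) :
    ∃ (c : Fin n → k) (l : Fin n), c l ≠ 0 ∧
      ∀ j : Fin i, ∑ l, MvPolynomial.coeff (Finsupp.single l 1) (q j) * c l = 0 := by
  let Φ : (Fin n → k) →ₗ[k] (Fin i → k) :=
    { toFun := fun c j => ∑ l, MvPolynomial.coeff (Finsupp.single l 1) (q j) * c l
      map_add' := fun c c' => by
        ext j; simp [mul_add, Finset.sum_add_distrib]
      map_smul' := fun a c => by
        ext j; simp [Finset.mul_sum, mul_left_comm] }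
  have hker : LinearMap.ker Φ ≠ ⊥ := LinearMap.ker_ne_bot_of_finrank_lt (by simpa using hin)
  obtain ⟨c, hcker, hc0⟩ := (Submodule.ne_bot_iff _).mp hker
  obtain ⟨l, hl⟩ := Function.ne_iff.mp hc0
  exact ⟨c, l, hl, fun j => congr_fun (LinearMap.mem_ker.mp hcker) j⟩

end Line

/-! ## The upper bound in a localisation at the origin -/

/-- **Fat-point upper bound.** In a localisation `L` of `k[x₁,…,xₙ]` at the origin
`𝔪₀ = ker (constant coefficient)`: if `v₁,…,vₘ` lie in the maximal ideal, the weights are positive and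
antitone, `d > 0`, and `(𝔪₀ L)²` is contained in the weighted piece `(v^α : Σ wⱼ αⱼ ≥ d)`, then the
chart profile does not exceed `(2,…,2,⊤,…)` (`n` twos). (The primality instance of `𝔪₀` is taken as
an argument: supply `RingHom.ker_isPrime _`.) [OURS · folklore] -/
theorem chartProfile_le_twoProfile_of_sq_le {n : ℕ} {k : Type} [Field k]
    {L : Type} [CommRing L] [IsLocalRing L] [Algebra (MvPolynomial (Fin n) k) L]
    [(RingHom.ker (MvPolynomial.constantCoeff : MvPolynomial (Fin n) k →+* k)).IsPrime]
    [IsLocalization.AtPrime L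
      (RingHom.ker (MvPolynomial.constantCoeff : MvPolynomial (Fin n) k →+* k))]
    {m : ℕ} (v : Fin m → L) (hv : ∀ j, v j ∈ IsLocalRing.maximalIdeal L)
    (w : Fin m → ℕ) (hw : ∀ j, 0 < w j) (hanti : Antitone w) (d : ℕ) (hd : 0 < d)
    (hle : ((RingHom.ker (MvPolynomial.constantCoeff : MvPolynomial (Fin n) k →+* k)).map
      (algebraMap (MvPolynomial (Fin n) k) L)) ^ 2 ≤ weightedMonomialIdeal v w d) :
    chartProfile d w ≤ chartProfile (m := n) 2 (fun _ => 1) := by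
  classical
  set A := MvPolynomial (Fin n) k with hA
  set 𝔪 : Ideal A := RingHom.ker (MvPolynomial.constantCoeff : MvPolynomial (Fin n) k →+* k)
    with h𝔪
  by_contra hcon
  rw [not_le] at hcon
  obtain ⟨i, hin, him, h2, h3⟩ := exists_index_of_twoProfile_lt hw hanti hcon
  -- numerators `q j` and denominators `s j` of the chart elements
  have hsurj := fun j => IsLocalization.surj 𝔪.primeCompl (v j)
  choose qs hqs using hsurj
  set q : Fin m → A := fun j => (qs j).1 with hq
  set s : Fin m → 𝔪.primeCompl := fun j => (qs j).2 with hs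
  have hqs' : ∀ j, v j * algebraMap A L (s j) = algebraMap A L (q j) := fun j => hqs j
  -- numerators vanish at the origin
  have hq𝔪 : ∀ j, MvPolynomial.constantCoeff (q j) = 0 := by
    intro j
    have hmem : algebraMap A L (q j) ∈ IsLocalRing.maximalIdeal L := by
      rw [← hqs' j]
      exact Ideal.mul_mem_right _ _ (hv j)
    exact RingHom.mem_ker.mp ((IsLocalization.AtPrime.to_map_mem_maximal_iff L 𝔪 (q j)).mp hmem)
  -- the weighted piece in `v` is contained in the extension of the weighted piece in `q`
  have hW : weightedMonomialIdeal v w d ≤ (weightedMonomialIdeal q w d).map (algebraMap A L) := by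
    rw [weightedMonomialIdeal, Ideal.span_le]
    rintro x ⟨α, hα, rfl⟩
    have hgen : algebraMap A L (∏ j, q j ^ α j) ∈
        (weightedMonomialIdeal q w d).map (algebraMap A L) :=
      Ideal.mem_map_of_mem _ (Ideal.subset_span ⟨α, hα, rfl⟩)
    have hprod : algebraMap A L (∏ j, q j ^ α j) =
        (∏ j, v j ^ α j) * algebraMap A L (∏ j, (s j : A) ^ α j) := by
      rw [map_prod, map_prod, ← Finset.prod_mul_distrib]
      refine Finset.prod_congr rfl fun j _ => ?_
      rw [map_pow, map_pow, ← mul_pow, hqs' j]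
    have hSmem : (∏ j, (s j : A) ^ α j) ∈ 𝔪.primeCompl := prod_mem fun j _ => pow_mem (s j).2 _
    obtain ⟨u, hu'⟩ := IsLocalization.map_units L (⟨_, hSmem⟩ : 𝔪.primeCompl)
    have heq : (∏ j, v j ^ α j) = algebraMap A L (∏ j, q j ^ α j) * ↑u⁻¹ := by
      rw [hprod, ← hu', mul_assoc, Units.mul_inv, mul_one]
    change (∏ j, v j ^ α j) ∈ (weightedMonomialIdeal q w d).map (algebraMap A L)
    rw [heq]
    exact Ideal.mul_mem_right _ _ hgen
  -- choose the line
  obtain ⟨c, l, hcl, hc⟩ :=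
    exists_line (k := k) hin (fun j : Fin i => q ⟨j, lt_of_lt_of_le j.2 him⟩)
  have hc' : ∀ j : Fin m, (j : ℕ) < i →
      ∑ l, MvPolynomial.coeff (Finsupp.single l 1) (q j) * c l = 0 :=
    fun j hj => hc ⟨j, hj⟩
  set φ : A →ₐ[k] k[X] := MvPolynomial.aeval fun l => Polynomial.C (c l) * Polynomial.X with hφdef
  have hφ : ∀ l, φ (MvPolynomial.X l) = Polynomial.C (c l) * Polynomial.X :=
    fun l => MvPolynomial.aeval_X _ l
  -- `x_l² ∈ 𝔪₀²` maps into the weighted piece, hence into the extension of the `q`-piece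
  have hXsq : algebraMap A L (MvPolynomial.X l ^ 2) ∈
      (weightedMonomialIdeal q w d).map (algebraMap A L) := by
    apply hW
    apply hle
    rw [← Ideal.map_pow]
    refine Ideal.mem_map_of_mem _ (Ideal.pow_mem_pow ?_ 2)
    exact RingHom.mem_ker.mpr (MvPolynomial.constantCoeff_X (R := k) l)
  -- clear denominators: `T · x_l² ∈ (q-piece)` with `T ∉ 𝔪₀`
  obtain ⟨⟨⟨a, ha⟩, t⟩, hat⟩ := (IsLocalization.mem_map_algebraMap_iff 𝔪.primeCompl L).mp hXsq
  simp only at hat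
  rw [← map_mul] at hat
  obtain ⟨e, he⟩ := (IsLocalization.eq_iff_exists 𝔪.primeCompl L).mp hat
  have hT𝔪 : ((e : A) * (t : A)) ∉ 𝔪 := by
    intro hmem
    rcases (inferInstance : 𝔪.IsPrime).mem_or_mem hmem with h | h
    · exact e.2 h
    · exact t.2 h
  have hTmem : (e : A) * (t : A) * MvPolynomial.X l ^ 2 ∈ weightedMonomialIdeal q w d := by
    have heq : (e : A) * (t : A) * MvPolynomial.X l ^ 2 = (e : A) * a := by
      rw [mul_assoc, mul_comm (t : A), he]
    rw [heq]
    exact Ideal.mul_mem_left _ _ ha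
  -- restrict to the line: the `q`-piece lands in `(t³)`
  have hline : φ ((e : A) * (t : A) * MvPolynomial.X l ^ 2) ∈
      Ideal.span {(Polynomial.X : k[X]) ^ 3} := by
    have hmap : (weightedMonomialIdeal q w d).map φ.toRingHom ≤
        Ideal.span {(Polynomial.X : k[X]) ^ 3} := by
      rw [weightedMonomialIdeal, Ideal.map_span, Ideal.span_le]
      rintro y ⟨x, ⟨α, hα, rfl⟩, rfl⟩
      rw [SetLike.mem_coe, Ideal.mem_span_singleton]
      exact X_pow_three_dvd_lineMap_prod c φ hφ q hq𝔪 hc' α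
        (three_le_weightedDegree hw hd h2 h3 α hα)
    exact hmap (Ideal.mem_map_of_mem _ hTmem)
  rw [Ideal.mem_span_singleton] at hline
  -- but its `t²`-coefficient is `T(0) · c_l² ≠ 0`
  have hcoeff : (φ ((e : A) * (t : A) * MvPolynomial.X l ^ 2)).coeff 2 =
      MvPolynomial.constantCoeff ((e : A) * (t : A)) * c l ^ 2 := by
    have hX2 : φ (MvPolynomial.X l ^ 2) = Polynomial.C (c l ^ 2) * Polynomial.X ^ 2 := by
      rw [map_pow, hφ, mul_pow, ← map_pow]
    rw [map_mul, hX2, ← mul_assoc, Polynomial.coeff_mul_X_pow', if_pos le_rfl, Nat.sub_self,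
      Polynomial.coeff_mul_C, coeff_zero_lineMap c φ hφ]
  have hzero : (φ ((e : A) * (t : A) * MvPolynomial.X l ^ 2)).coeff 2 = 0 :=
    (Polynomial.X_pow_dvd_iff.mp hline) 2 (by norm_num)
  rw [hcoeff] at hzero
  rcases mul_eq_zero.mp hzero with h0 | h0
  · exact hT𝔪 (RingHom.mem_ker.mpr h0)
  · exact hcl ((pow_eq_zero_iff two_ne_zero).mp h0)

end Summit.ResolutionOfSingularities.ResolutionOfSingularities.Theorems.PointwiseLexmaxHull

end
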